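import Summits.CriticalPhenomena.PercolationContinuityZ3.Theorems.FK.Transplant.KNFreeRegressionQOneBinders
import Summits.CriticalPhenomena.PercolationContinuityZ3.Theorems.FK.Transplant.FreeBoundaryTransplant
import HarnessLib

/-!
# G-T2, part 3: the record theorem of the conditional KN transplant instantiated at `q = 1` (FT-09)

**CONDITIONAL sub-cell context: `FH` and `KNFreeTargetHittable` (= TP_FK) are OPEN at the same `p` for `q > 1`
(⇔ GRC Conj. (5.103) via K1; barrier note
`Literature.Barriers.CriticalPhenomena.SamePFreeBoundaryCriteria`, decl `samePFreeBoundaryCriteria`);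
the transplant is a typed reduction, not a proof of FK continuity.** This file is
checklist C5 of the referee gate G-T2: the theorem of record `ufsc0_of_freeBoundaryHypothesis_r0`
(`Transplant/FreeBoundaryTransplant.lean`) fed with the six UNCONDITIONAL `q = 1` regressions of
`Transplant/KNFreeRegressionQOne.lean` (FH = KN Lemma 9) and `Transplant/KNFreeRegressionQOneBinders.lean`
(TP = Lemma 10, Lemma 11, Lemma 12, (32) at the origin, Steps II–IV) gives — THROUGH p205010's additive-gluing
kernel: `CSH.additiveGluing_holds` enters the cone via the TP regression `knFreeTargetHittable_one` ←
`Quant.targetProperty_of_theta_pos` (234 `Theorems.CSH.*` constants; the other five regressions carry none; the headline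
declarations `CSH.percolationContinuityZ3_holds` / `CSH.kozmaNitzan_conjecture3_holds` and the conditional Prop
`KozmaNitzan2024_conjecture3` are in no cone; fk-ref R-g13-1, 2026-08-21) —
`ufsc0_one_of_theta_pos : 3 ≤ d → 0 < p < 1 → 0 < θ(p) → ∀ ε₀ > 0, ∃ r, UFSC0 d 1 p r ε₀`.
Builds on p205010 (kernel theorem, internal audit signed; external expert review pending). Writer+proposer
fkp-01-g2 (delegated by fkt-lead, INBOX 2026-08-21T01:16Z; spec `FT09-SPEC.md` Part 2).
[cite: KozmaNitzan2024, §4 Theorem 6 (pp. 25–31) with Lemmas 9–12] [cite: Grimmett2006, Conj. (5.103)]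
-/

noncomputable section

namespace Summit.CriticalPhenomena.PercolationContinuityZ3.Theorems.FK

open MeasureTheory Literature.Probability.Percolation Literature.Probability.LatticeModels SimpleGraph
open Literature.Probability.Percolation.GadgetSystem Literature.Probability.Percolation.KozmaNitzan

variable {d : ℕ}

/-! ### 7. The unconditional `q = 1` statement (checklist C5) -/

/-- **G-T2, the record instantiated at `q = 1`**: for `d ≥ 3`, `0 < p < 1` and `θ(p) > 0`, the uniform finite-size
criterion `UFSC0 d 1 p r ε₀` holds at some scale `r`, for every `ε₀ > 0` — UNCONDITIONALLY: the theorem of record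
`ufsc0_of_freeBoundaryHypothesis_r0` fed with the six `q = 1` regressions of `KNFreeRegressionQOne.lean` / `KNFreeRegressionQOneBinders.lean` (FH: KN Lemma 9; TP: Lemma 10;
Lemma 11; Lemma 12; (32) at the origin; Steps II–IV). Cone: contains p205010's additive-gluing theorem
`CSH.additiveGluing_holds` (through TP = KN Lemma 10 at `q = 1`), not `CSH.percolationContinuityZ3_holds` /
`CSH.kozmaNitzan_conjecture3_holds` (fk-ref R-g13-1).
[cite: KozmaNitzan2024, §4 Theorem 6 (pp. 25–31) with Lemmas 9–12] -/
theorem ufsc0_one_of_theta_pos (hd : 3 ≤ d) (p : unitInterval) (hp0 : 0 < (p : ℝ)) (hp1 : (p : ℝ) < 1)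
    (hθ : 0 < theta (zdGraph d) 0 p) {ε₀ : ℝ} (hε₀ : 0 < ε₀) : ∃ r : ℕ, UFSC0 d 1 p r ε₀ := by
  haveI : NeZero d := ⟨by omega⟩
  exact ufsc0_of_freeBoundaryHypothesis_r0 hd le_rfl hε₀ p ⟨hp0, hp1⟩ (fh_one_of_theta_pos (by omega) p hθ hp1)
    (knFreeTargetHittable_one p hp0 hp1 hθ) (knFreeElongatedHittable_one p hp1 hθ)
    (knFreeCorridorRestr_one p hp1 hθ) (knFreeOriginLook_one p) (knFreeBadRestr_one p)

/-- `d = 3` instance of the unconditional `q = 1` statement. [cite: KozmaNitzan2024, §4 Theorem 6 (pp. 25–31)] -/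
theorem ufsc0_three_one_of_theta_pos (p : unitInterval) (hp0 : 0 < (p : ℝ)) (hp1 : (p : ℝ) < 1)
    (hθ : 0 < theta (zdGraph 3) 0 p) {ε₀ : ℝ} (hε₀ : 0 < ε₀) : ∃ r : ℕ, UFSC0 3 1 p r ε₀ :=
  ufsc0_one_of_theta_pos (by norm_num) p hp0 hp1 hθ hε₀

end Summit.CriticalPhenomena.PercolationContinuityZ3.Theorems.FK

end
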